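import Summits.ABC.ABC.Theorems.DefiniteXiDefiniteRTControlPrimeValTransport
import Literature.NumberTheory.EllipticCurves.PastenHeightBoundsLemma68LocalProofs
import Literature.NumberTheory.EllipticCurves.KleinFrickeLevelTwentySeven
import Literature.NumberTheory.EllipticCurves.KenkuLevelFortyNineProofs
import Summits.ABC.ABC.Theorems.IsogenyGlueCongruenceMazurKenkuBoundLevelThirtyTwo
import Literature.NumberTheory.EllipticCurves.OpenImageMazurInputs
import Literature.NumberTheory.EllipticCurves.KleinFrickeLevelThirteen
import Literature.NumberTheory.EllipticCurves.BSDSelmerSmithCases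
import Literature.NumberTheory.DiophantineGeometry.DenesEquationLargeExponentsProofs
import HarnessLib

/-!
# Stub ideas k2 (gen 2, family RESHAPE) — `stub_pastenLemma68 : PastenShimura2024_lemma_6_8`
(crux `DefiniteRTControlPrime`, stmt-ABC-11338, route `DefiniteXi`, skeleton `Lines/Sketch.lean`).

Helper lemmas, elaborated.  PROVED (no `sorry`): R0a/R0b (exact transport identity `c·b = c'·a`,
`ab = deg`, hence `deg · c = a² · c'`), R0c (Lemma-6.8 shape from ANY isogeny of degree `≤ R`, with
the product rider `mn ≤ R`), R1 glue (`FreyIsogenyRadius R →` the conclusion of `stub_valTransport`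
with `163 ↦ R`), E27/E32/E49 (no cyclic sub-degree `27`, `32`, `49` out of a Frey curve — landed
levels + `j(Frey) ≥ 0`).  SORRIED (signatures only, the plan's prover targets): D0, F1⁺, F2, F4,
A (arithmetic), TOP.
-/

set_option linter.dupNamespace false

noncomputable section

open scoped Classical
open WeierstrassCurve IsDedekindDomain
open Literature.NumberTheory.EllipticCurves Literature.NumberTheory.EllipticCurves.ModularForms
open Literature.NumberTheory.DiophantineGeometry

namespace Summit.ABC.ABC.Cruxes.DefiniteRTControlPrime.StubIdeas2G2

/-! ### R0. The exact transport identity along a cyclic isogeny (Mazur-free, PROVED) -/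

/-- **R0a.** Sharpening of the tree's `exists_ordMinimalDiscriminant_mul_eq_mul_of_isCyclic`
(`ab ∣ n`) to the EXACT `ab = n`: along a cyclic `ℚ`-isogeny of degree `n` between curves
multiplicative at `v`, `c_v(W) · b = c_v(W') · a` with `a · b = n` (Tate: the kernel meets `μ_n` in
order `b`; `q' = ζ q^{b/a}`).  Same strong induction; only the bookkeeping changes. -/
theorem exists_ordMinimalDiscriminant_mul_eq_mul_of_isCyclic_exact (n : ℕ) :
    ∀ {W W' : WeierstrassCurve ℚ} [W.IsElliptic] [W'.IsElliptic] (φ : Isogeny W W'),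
      φ.IsCyclic → φ.degree = n → ∀ v : HeightOneSpectrum ℤ, W.HasMultiplicativeReductionAt v →
        W'.HasMultiplicativeReductionAt v →
          ∃ a b : ℕ, 0 < a ∧ 0 < b ∧ a * b = n ∧
            W.ordMinimalDiscriminant v * b = W'.ordMinimalDiscriminant v * a := by
  induction n using Nat.strong_induction_on with
  | _ n ih =>
    intro W W' _ _ φ hφ hdeg v hv hv'
    by_cases h1 : n = 1
    · subst h1
      refine ⟨1, 1, one_pos, one_pos, by norm_num, ?_⟩
      have hj := φ.j_eq_of_degree_eq_one hdeg
      have h := valuation_j_eq_exp_ordMinimalDiscriminant W v hv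
      rw [hj, valuation_j_eq_exp_ordMinimalDiscriminant W' v hv', WithZero.exp_inj] at h
      rw [mul_one, mul_one]
      exact_mod_cast h.symm
    · have hn0 : n ≠ 0 := by rw [← hdeg]; exact φ.degree_pos.ne'
      have hn1 : 1 < n := by omega
      set ℓ := n.minFac with hℓdef
      have hℓ : ℓ.Prime := Nat.minFac_prime h1
      have hℓn : ℓ ∣ n := Nat.minFac_dvd n
      obtain ⟨W'', hW'', ψ, lam, hψcyc, hψdeg, hlamcyc, hlamdeg⟩ :=
        exists_isCyclic_factor_of_dvd φ hφ (hdeg ▸ hℓn)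
      haveI := hW''
      rw [hdeg] at hlamdeg
      have hv'' : W''.HasMultiplicativeReductionAt v :=
        hasMultiplicativeReductionAt_of_isIsogenous ⟨ψ⟩ v hv
      have hstep := ordMinimalDiscriminant_eq_mul_or_of_degree_eq_prime ψ hℓ hψdeg v hv hv''
      have hlt : lam.degree < n := by
        have h2 := hℓ.two_le
        have hpos := lam.degree_pos
        nlinarith
      obtain ⟨a, b, ha, hb, hab, heq⟩ := ih lam.degree hlt lam hlamcyc rfl v hv'' hv'
      rcases hstep with hs | hs
      · refine ⟨ℓ * a, b, Nat.mul_pos hℓ.pos ha, hb, ?_, ?_⟩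
        · rw [← hlamdeg, ← hab]; ring
        · rw [hs, mul_assoc, heq]; ring
      · refine ⟨a, ℓ * b, ha, Nat.mul_pos hℓ.pos hb, ?_, ?_⟩
        · rw [← hlamdeg, ← hab]; ring
        · rw [← heq, hs]; ring

/-- **R0b.** The squared form: `deg φ · c_v(W) = a² · c_v(W')` with `a ∣ deg φ` (`a` = the part of
the cyclic kernel mapping onto the component group at `v`). Exposes the EXACT loss of the skeleton's
two transports: one isogeny, one integer `a`. -/
theorem degree_mul_ordMinimalDiscriminant_eq_sq_mul {W W' : WeierstrassCurve ℚ} [W.IsElliptic]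
    [W'.IsElliptic] (φ : Isogeny W W') (hφ : φ.IsCyclic) (v : HeightOneSpectrum ℤ)
    (hv : W.HasMultiplicativeReductionAt v) (hv' : W'.HasMultiplicativeReductionAt v) :
    ∃ a : ℕ, 0 < a ∧ a ∣ φ.degree ∧
      φ.degree * W.ordMinimalDiscriminant v = a ^ 2 * W'.ordMinimalDiscriminant v := by
  obtain ⟨a, b, ha, -, hab, h⟩ :=
    exists_ordMinimalDiscriminant_mul_eq_mul_of_isCyclic_exact φ.degree φ hφ rfl v hv hv'
  refine ⟨a, ha, ⟨b, hab.symm⟩, ?_⟩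
  rw [← hab]
  calc a * b * W.ordMinimalDiscriminant v = a * (W.ordMinimalDiscriminant v * b) := by ring
    _ = a * (W'.ordMinimalDiscriminant v * a) := by rw [h]
    _ = a ^ 2 * W'.ordMinimalDiscriminant v := by ring

/-- **R0c.** Lemma-6.8 SHAPE from ANY `ℚ`-isogeny of degree `≤ R` (generic constant, pointwise in
the pair — no global radius, no Mazur–Kenku): `c_v(W) · n = c_v(W') · m` with `m n ≤ R`. -/
theorem lemma68Shape_of_degree_le {R : ℕ} {W W' : WeierstrassCurve ℚ} [W.IsElliptic]
    [W'.IsElliptic] (φ : Isogeny W W') (hR : φ.degree ≤ R) (v : HeightOneSpectrum ℤ)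
    (hv : W.HasMultiplicativeReductionAt v) :
    ∃ m n : ℕ, 0 < m ∧ 0 < n ∧ m * n ≤ R ∧
      W.ordMinimalDiscriminant v * n = W'.ordMinimalDiscriminant v * m := by
  have hv' : W'.HasMultiplicativeReductionAt v :=
    hasMultiplicativeReductionAt_of_isIsogenous ⟨φ⟩ v hv
  obtain ⟨ψ, hcyc, hdvd⟩ := φ.exists_isCyclic_degree_dvd
  obtain ⟨a, b, ha, hb, hab, h⟩ :=
    exists_ordMinimalDiscriminant_mul_eq_mul_of_isCyclic_exact ψ.degree ψ hcyc rfl v hv hv'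
  refine ⟨a, b, ha, hb, ?_, h⟩
  rw [hab]
  exact (Nat.le_of_dvd φ.degree_pos hdvd).trans hR

/-! ### R1. The RESHAPED leaf: a Frey-class isogeny radius with a free constant -/

/-- **The reshaped stub statement** (replaces `stub_pastenLemma68`, all classes, Mazur–Kenku-complete,
by what `DefiniteRTControlPrime_of` instantiates): every curve `ℚ`-isogenous to a Frey curve
`E_(a,b)` having an odd conductor prime is reached from it by a `ℚ`-isogeny of degree `≤ R`. -/
def FreyIsogenyRadius (R : ℕ) : Prop :=
  ∀ (a b : ℤ), IsCoprime a b → a * b * (a + b) ≠ 0 → ∀ q : ℕ, q.Prime → q ≠ 2 →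
    q ∣ (freyCurve a b).conductorNorm ℤ →
    ∀ (W' : WeierstrassCurve ℚ) [W'.IsElliptic], (freyCurve a b).IsIsogenous W' →
      ∃ φ : Isogeny (freyCurve a b) W', φ.degree ≤ R

/-- **R1 glue (PROVED).** `FreyIsogenyRadius R` gives the conclusion of the skeleton's
`stub_valTransport` with `163 ↦ R` — same proof as the landed `stub_valTransport` (p96813) with R0c
in place of Lemma 6.8; the composition then runs with `C = 4 · 163 · R`. -/
theorem valTransport_of_freyIsogenyRadius {R : ℕ} (hR : FreyIsogenyRadius R) :
    ∀ (a b : ℤ), IsCoprime a b → a * b * (a + b) ≠ 0 → ∀ q : ℕ, q.Prime → q ≠ 2 →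
      q ∣ (freyCurve a b).conductorNorm ℤ →
      ∀ (W' : WeierstrassCurve ℚ) [W'.IsElliptic], (freyCurve a b).IsIsogenous W' →
        (W'.minimalDiscriminantNorm ℤ).factorization q ≤
          R * ((freyCurve a b).minimalDiscriminantNorm ℤ).factorization q := by
  intro a b hab h0 q hq hq2 hqN W' _ hiso
  haveI := isElliptic_freyCurve h0
  obtain ⟨v, hv⟩ :
      ∃ v : HeightOneSpectrum ℤ, Rat.HeightOneSpectrum.natGenerator v = q :=
    ⟨(Rat.HeightOneSpectrum.primesEquiv (R := ℤ)).symm ⟨q, hq⟩,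
      Rat.natGenerator_primesEquiv_symm ⟨q, hq⟩⟩
  have hdvd : (q : ℤ) ∣ a * b * (a + b) := dvd_of_dvd_conductorNorm_freyCurve hab h0 hq hq2 hqN
  have hmult : (freyCurve a b).HasMultiplicativeReductionAt v :=
    hasMultiplicativeReductionAt_freyCurve_of_ne_two hab h0 v (hv ▸ hq2) (hv ▸ hdvd)
  obtain ⟨φ, hφ⟩ := hR a b hab h0 q hq hq2 hqN W' hiso
  obtain ⟨m, n, hm0, -, hmn, hmnEq⟩ := lemma68Shape_of_degree_le φ hφ v hmult
  have hn : n ≤ R := le_trans (Nat.le_mul_of_pos_left n hm0) hmn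
  have h1 := factorization_minimalDiscriminantNorm_holds (freyCurve a b) v
  have h2 := factorization_minimalDiscriminantNorm_holds W' v
  rw [hv] at h1 h2
  rw [h1, h2]
  calc W'.ordMinimalDiscriminant v
      ≤ W'.ordMinimalDiscriminant v * m := Nat.le_mul_of_pos_right _ hm0
    _ = (freyCurve a b).ordMinimalDiscriminant v * n := hmnEq.symm
    _ ≤ (freyCurve a b).ordMinimalDiscriminant v * R := Nat.mul_le_mul_left _ hn
    _ = R * (freyCurve a b).ordMinimalDiscriminant v := Nat.mul_comm _ _

/-! ### R1 inputs.  Exclusions out of a Frey curve (E27/E32/E49 PROVED; D0/F1⁺/F2/F4/A sorried) -/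

/-- `j(E_(a,b)) = 2⁸ (a² + ab + b²)³ / (ab(a+b))² ≥ 0` (`j_freyCurve`). -/
theorem j_freyCurve_nonneg {a b : ℤ} [(freyCurve a b).IsElliptic] (h0 : a * b * (a + b) ≠ 0) :
    0 ≤ (freyCurve a b).j := by
  rw [j_freyCurve h0]
  have hx : 0 ≤ (a : ℚ) ^ 2 + a * b + b ^ 2 := by
    nlinarith [sq_nonneg ((a : ℚ) + b), sq_nonneg (a : ℚ), sq_nonneg (b : ℚ)]
  exact div_nonneg (mul_nonneg (by norm_num) (pow_nonneg hx 3)) (sq_nonneg _)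

/-- **E27 (PROVED).** No cyclic sub-degree `27` out of a Frey curve: the landed level-`27` table
(`Isogeny.j_eq_of_isCyclic_degree_twentySeven`: `j = −2¹⁵·3·5³ < 0`) vs `j(Frey) ≥ 0`. So the
`3`-part of a cyclic degree out of `E_(a,b)` is `≤ 9` — levels `36/54/81` are never needed. -/
theorem not_twentySeven_dvd_degree_of_freyCurve {a b : ℤ} (h0 : a * b * (a + b) ≠ 0)
    {W' : WeierstrassCurve ℚ} [W'.IsElliptic] (ψ : Isogeny (freyCurve a b) W')
    (hψ : ψ.IsCyclic) : ¬ 27 ∣ ψ.degree := by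
  haveI := isElliptic_freyCurve h0
  intro h27
  obtain ⟨W'', hW'', χ, hχcyc, hχdeg, -⟩ := ψ.exists_isCyclic_degree_eq_of_dvd hψ h27
  haveI := hW''
  have hj := χ.j_eq_of_isCyclic_degree_twentySeven hχcyc hχdeg
  have hnn := j_freyCurve_nonneg (a := a) (b := b) h0
  rw [hj] at hnn
  norm_num at hnn

/-- **E32 (PROVED).** No cyclic sub-degree `32` (landed `isogeny_isCyclic_degree_ne_thirtyTwo`):
the `2`-part of a cyclic degree out of any curve is `≤ 16` (and `≤ 8` out of a full-2-torsion
curve by F1⁺). -/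
theorem not_thirtyTwo_dvd_degree {W W' : WeierstrassCurve ℚ} [W.IsElliptic] [W'.IsElliptic]
    (ψ : Isogeny W W') (hψ : ψ.IsCyclic) : ¬ 32 ∣ ψ.degree := by
  intro h32
  obtain ⟨W'', hW'', χ, hχcyc, hχdeg, -⟩ := ψ.exists_isCyclic_degree_eq_of_dvd hψ h32
  haveI := hW''
  exact Summit.ABC.ABC.Theorems.isogeny_isCyclic_degree_ne_thirtyTwo χ hχcyc hχdeg

/-- **E49 (PROVED).** No cyclic sub-degree `49` (landed `isogeny_isCyclic_degree_ne_fortyNine`). -/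
theorem not_fortyNine_dvd_degree {W W' : WeierstrassCurve ℚ} [W.IsElliptic] [W'.IsElliptic]
    (ψ : Isogeny W W') (hψ : ψ.IsCyclic) : ¬ 49 ∣ ψ.degree := by
  intro h49
  obtain ⟨W'', hW'', χ, hχcyc, hχdeg, -⟩ := ψ.exists_isCyclic_degree_eq_of_dvd hψ h49
  haveI := hW''
  exact Literature.NumberTheory.EllipticCurves.isogeny_isCyclic_degree_ne_fortyNine χ hχcyc hχdeg

/-- **D0 (S).** A Frey curve has full rational `2`-torsion (`(0,0), (a,0), (−b,0)`:
`freyCurve_two_torsion`), in the tree's `ratTwoTorsionCard` vocabulary. -/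
theorem stub_ratTwoTorsionCard_freyCurve {a b : ℤ} (h0 : a * b * (a + b) ≠ 0) :
    ratTwoTorsionCard (freyCurve a b) = 4 := by
  sorry

/-- **F1⁺ (M, NEW; the `2`-power push).** Full rational `2`-torsion and a cyclic `ℚ`-isogeny of
degree `2ᵏ·m` (`k ≥ 1`, `m` odd) out of `W` give a cyclic `ℚ`-isogeny of degree `2ᵏ⁺¹·m` out of a
`2`-neighbour: with `E[2] = {0,P₁,P₂,P₃}`, `C = C_{2ᵏ} ⊕ C_m`, `2ᵏ⁻¹R = P₁`, take
`K = ⟨y, P₂⟩ ⊕ C_m` (`2y = R`): `K` is `Γ_ℚ`-stable, `K/⟨P₂⟩` is cyclic of order `2ᵏ⁺¹m`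
(`2ᵏ·ȳ = P̄₁ ≠ 0`), quotient `exists_isogeny_ker_eq_and_comp_eq_nsmul_holds`, factor
`Isogeny.exists_eq_comp_of_ker_le`.  (The odd case `k = 0 ↦ 4m` is k3's F1, not restated.) -/
theorem stub_fullTwoTorsion_push_two {W W' : WeierstrassCurve ℚ} [W.IsElliptic] [W'.IsElliptic]
    (h4 : ratTwoTorsionCard W = 4) (ψ : Isogeny W W') (hψ : ψ.IsCyclic) {k m : ℕ} (hk : 1 ≤ k)
    (hm : Odd m) (hdeg : ψ.degree = 2 ^ k * m) :
    ∃ (V V' : WeierstrassCurve ℚ) (_ : V.IsElliptic) (_ : V'.IsElliptic) (χ : Isogeny V V'),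
      W.IsIsogenous V ∧ χ.IsCyclic ∧ χ.degree = 2 ^ (k + 1) * m := by
  sorry

/-- **F2 (S–M; = k3 Plan 2 H1∘H2, dictionary form).** Mazur Cor. 4.4 at an ODD multiplicative place
of `ℤ`: a prime dividing a cyclic `ℚ`-isogeny degree out of `W` is `≤ 7` or `13` (cyclic factor of
degree `ℓ` ↦ a `Γ_ℚ`-stable `C ⊂ W[ℓ]` of order `ℓ`; `ℓ = 11 ∨ 17 ≤ ℓ` would force `|j|_v ≤ 1`,
against `one_lt_valuation_j_of_hasMultiplicativeReductionAt`; place bridge `ℤ ↔ 𝓞 ℚ` as in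
`hasMultiplicativeReductionAt_of_isIsogenous`).  NO prime `j`-table is used. -/
theorem stub_prime_dvd_degree_of_cor44 (h44 : Mazur1978.cor44_valuation_j_le_one)
    {W W' : WeierstrassCurve ℚ} [W.IsElliptic] [W'.IsElliptic] (ψ : Isogeny W W')
    (hψ : ψ.IsCyclic) (v : HeightOneSpectrum ℤ) (hv2 : Rat.HeightOneSpectrum.natGenerator v ≠ 2)
    (hv : W.HasMultiplicativeReductionAt v) {ℓ : ℕ} (hℓ : ℓ.Prime) (hℓd : ℓ ∣ ψ.degree) :
    ℓ ≤ 7 ∨ ℓ = 13 := by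
  sorry

/-- **F4 (S–M).** A rational `2`-torsion point and a cyclic sub-degree `13` give a cyclic `26`
(`ker χ₁₃ ⊕ ⟨P⟩`, coprime orders), excluded by the landed `isCyclic_degree_ne_twentySix h13`
(Kenku level `26` modulo the cite-only Klein–Fricke-13 identity). -/
theorem stub_thirteen_not_dvd_degree (h13 : kleinFrickeThirteen_exists_j_eq)
    {W W' : WeierstrassCurve ℚ} [W.IsElliptic] [W'.IsElliptic] (h2 : ratTwoTorsionCard W ≠ 1)
    (ψ : Isogeny W W') (hψ : ψ.IsCyclic) : ¬ 13 ∣ ψ.degree := by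
  sorry

/-- **F5 (S, from k3's F1 + landed level 20).** Full rational `2`-torsion excludes the sub-degree `5`
(`C₅ ↦` a cyclic `20` out of `W/⟨P₁⟩`, `isogeny_isCyclic_degree_ne_twenty_holds`). -/
theorem stub_five_not_dvd_degree {W W' : WeierstrassCurve ℚ} [W.IsElliptic] [W'.IsElliptic]
    (h4 : ratTwoTorsionCard W = 4) (ψ : Isogeny W W') (hψ : ψ.IsCyclic) : ¬ 5 ∣ ψ.degree := by
  sorry

/-- **A (S, arithmetic).** Prime support `⊆ {2,3,7}` and the caps `32 ∤ d`, `27 ∤ d`, `49 ∤ d`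
give `d ∣ 1008 = 2⁴·3²·7` (`Nat.factorization_le_iff_dvd`,
`Nat.Prime.pow_dvd_iff_le_factorization`). -/
theorem stub_dvd_1008 {d : ℕ} (hd : d ≠ 0) (hS : ∀ ℓ : ℕ, ℓ.Prime → ℓ ∣ d → ℓ = 2 ∨ ℓ = 3 ∨ ℓ = 7)
    (h32 : ¬ 32 ∣ d) (h27 : ¬ 27 ∣ d) (h49 : ¬ 49 ∣ d) : d ∣ 1008 := by
  sorry

/-- **TOP (the reshaped leaf's discharge, 1 cycle once D0/F2/F4/F5/A are in).** For `W' ~ E_(a,b)`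
take a cyclic `ψ : E → W'` (`IsIsogenous.exists_isCyclic`); its prime divisors are in `{2,3,7}`
(F2 at the place over the odd `q ∣ N`, where `E` is multiplicative —
`hasMultiplicativeReductionAt_freyCurve_of_ne_two`; F5; F4 with D0), and E32/E27/E49 cap the
exponents; A gives `deg ψ ∣ 1008`.  Bill: Mazur Cor. 4.4 (item MazurCor44, stmt-ABC-18223) and the
cite-only Klein–Fricke-13 identity — NO Kenku prime table, NO level 35/65/125/169
(item KenkuPrintedLevels, stmt-ABC-18224, leaves this leaf's cone).  With F1⁺: `∣ 504`. -/
theorem stub_freyIsogenyRadius (h44 : Mazur1978.cor44_valuation_j_le_one)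
    (h13 : kleinFrickeThirteen_exists_j_eq) : FreyIsogenyRadius 1008 := by
  sorry

/-- **The skeleton edit** (`hval` of `DefiniteRTControlPrime_of`, constant `4·163·1008`): -/
theorem valTransport1008 (h44 : Mazur1978.cor44_valuation_j_le_one)
    (h13 : kleinFrickeThirteen_exists_j_eq) :
    ∀ (a b : ℤ), IsCoprime a b → a * b * (a + b) ≠ 0 → ∀ q : ℕ, q.Prime → q ≠ 2 →
      q ∣ (freyCurve a b).conductorNorm ℤ →
      ∀ (W' : WeierstrassCurve ℚ) [W'.IsElliptic], (freyCurve a b).IsIsogenous W' →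
        (W'.minimalDiscriminantNorm ℤ).factorization q ≤
          1008 * ((freyCurve a b).minimalDiscriminantNorm ℤ).factorization q :=
  valTransport_of_freyIsogenyRadius (stub_freyIsogenyRadius h44 h13)

/-! ### R2. For comparison: the verbatim stub from the radius ITEM with the product rider -/

/-- **R2 (PROVED, 6 lines; k1-g2 `lemma68_of_radius` is the same without `mn ≤ 163`).** -/
theorem lemma68_of_radiusItem (hRad : Summit.ABC.ABC.Theses.DefiniteXi.MazurKenkuRadius) :
    PastenShimura2024_lemma_6_8 := by
  intro W W' _ _ hiso v hv
  obtain ⟨φ, hφ⟩ := hRad W W' hiso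
  obtain ⟨m, n, hm, hn, hmn, h⟩ := lemma68Shape_of_degree_le φ hφ v hv
  refine ⟨m, n, hm, ?_, hn, ?_, h⟩
  · exact le_trans (Nat.le_mul_of_pos_right m hn) hmn
  · exact le_trans (Nat.le_mul_of_pos_left n hm) hmn

end Summit.ABC.ABC.Cruxes.DefiniteRTControlPrime.StubIdeas2G2

end
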